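import Summits.QuantumFields.YangMills.Theorems.BalabanLadderIRTwistedSlabExpChartOrbit
import Summits.QuantumFields.YangMills.Theorems.BalabanLadderIRTwistedSlabSeparation
import HarnessLib

/-!
# One identifier for the T1 integrand's exponent: `twistedExponent k U`, its `rfl` link to `wilsonFinTorusTensorTwistedPartition`, and the
# K2–K7 statements read through it (critic's soft ask S43-1)

HELPER toward stub **T1** `TwistedSlabAnchor` (LINE `twisted-slab-continuity`, crux `IRcof` stmt-QuantumFields-26930, census row 43;
LEAD prover ym-ir-line-tsc-p1 g3; `--supports` the crux, `--as helper`).  Answers crit-3 g4's S43-1 (bus 22:16:12Z): «link BY NAME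
`wilsonFinTorusTensorTwistedPartition (fundamentalRep (Fin N)) β (slabTwist (suCenter N k) 1) … = ∫ U, exp(−β · twistedExponent k U) ∂…` so that the
T1-box statement consumes K3–K6 through one identifier and no later seat can differentiate a look-alike».
* §1 `twistedExponent k U` — the exponent `Σ_x Σ_{μ<ν} (N − Re tr ρ_fund(w_x(μ,ν) · P_U(x;μ,ν)))` of the magnetic-slab summands (`z^{k′} = 1`) of
  `projSlabZ` for `G = SU(N)`, `z = ω^k·1`, defining representation; ★ `wilsonFinTorusTensorTwistedPartition_slab_fundamental` (`rfl`):
  the tree's partition function IS `∫ exp(−β · twistedExponent k U) dHaar^E`.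
* §2 the landed statements through the identifier: `twistedExponent_nonneg`, `continuous_twistedExponent`, `twistedExponent_gaugeAct` (gauge
  invariance), ★★ `twistedExponent_eq_zero_iff` (K2: zero set = `⋃ 𝒢 • ladder(A, B, ω^i·1, ω^j·1)`), ★ `twistedExponent_along_eq_lineAction` (K3e),
  ★★★ `twistedExponent_hessian_gap_of_vacuum` (K3f: ladder-free Coulomb-gauge gap of the second variation at every vacuum, uniform in `L, T`),
  ★★ `twistedExponent_separation` (K7: `η > 0` below the exponent outside any open set containing the critical orbits),
  `twistedExponent_chart` (K4∕K5∕K6 act on `chartAction (↑U) (slabTwistPhase k)`, whose value at `a` is the exponent of the chart configuration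
  whenever that configuration is `SU(N)`-valued: `twistedExponent_eq_chartAction_of_coe`).
NOT here: anything new mathematically; T1-box 0∕1, T1 proper 0∕1.

HONEST FRAMING: naming∕bookkeeping; nothing here bears on `IRcof`, `IR`, or the Yang–Mills mass gap (Clay: NOT proved); R4 = `BalabanLadder.UV` only.
References: 't Hooft, NPB 153 (1979) §2 (2.5)–(2.6); M. García Pérez, A. González-Arroyo, M. Okawa, JHEP 10 (2017) 150 §2.2–§2.5.
-/

set_option autoImplicit false

noncomputable section

open scoped Matrix
open Finset NormedSpace MeasureTheory
open Literature.MathematicalPhysics.QuantumFieldTheory Literature.MathematicalPhysics.QuantumLattice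
open Literature.MathematicalPhysics.QuantumLattice.WilsonSecondVariation

namespace Summit.QuantumFields.YangMills.Cruxes.IRcof.TwistedSlab

variable {N : ℕ} {n₀ n₁ n₂ n₃ : ℕ}

/-! ## §1 The identifier and its `rfl` link to the partition function -/

section Def

/-- **The exponent of the T1 integrand** (magnetic-slab summands of `projSlabZ`, `G = SU(N)`, `z = ω^k·1`, defining representation):
`twistedExponent k U = Σ_x Σ_{μ<ν} (N − Re tr ρ_fund(tHooftTwistTensor (slabTwist (ω^k·1) 1) x μ ν · P_U(x; μ, ν)))`.
[cite: tHooft1979Flux, §2 (2.6)] -/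
def twistedExponent (k : ZMod N) (U : FinTorusSite n₀ n₁ n₂ n₃ × Fin 4 → Matrix.specialUnitaryGroup (Fin N) ℂ) : ℝ :=
  ∑ x : FinTorusSite n₀ n₁ n₂ n₃, ∑ q : {q : Fin 4 × Fin 4 // q.1 < q.2},
    ((N : ℝ) - (fundamentalRep (Fin N) (tHooftTwistTensor (slabTwist (suCenter N k : Matrix.specialUnitaryGroup (Fin N) ℂ) 1)
      x q.1.1 q.1.2 * finTorusPlaquette U x q.1.1 q.1.2)).trace.re)

/-- Unfolding lemma. [cite: tHooft1979Flux, §2 (2.6)] -/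
theorem twistedExponent_def (k : ZMod N) (U : FinTorusSite n₀ n₁ n₂ n₃ × Fin 4 → Matrix.specialUnitaryGroup (Fin N) ℂ) :
    twistedExponent k U = ∑ x : FinTorusSite n₀ n₁ n₂ n₃, ∑ q : {q : Fin 4 × Fin 4 // q.1 < q.2},
      ((N : ℝ) - (fundamentalRep (Fin N) (tHooftTwistTensor (slabTwist (suCenter N k : Matrix.specialUnitaryGroup (Fin N) ℂ) 1)
        x q.1.1 q.1.2 * finTorusPlaquette U x q.1.1 q.1.2)).trace.re) := rfl

/-- ★ **S43-1: the tree's twisted partition function of the magnetic `SU(N)` slab in the defining representation IS the Haar integral of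
`exp(−β · twistedExponent k U)`** (definitional). [cite: tHooft1979Flux, §2 (2.6)] -/
theorem wilsonFinTorusTensorTwistedPartition_slab_fundamental (β : ℝ) (k : ZMod N) (n₀ n₁ n₂ n₃ : ℕ) :
    wilsonFinTorusTensorTwistedPartition (fundamentalRep (Fin N)) β
        (slabTwist (suCenter N k : Matrix.specialUnitaryGroup (Fin N) ℂ) 1) n₀ n₁ n₂ n₃ =
      ∫ U : FinTorusSite n₀ n₁ n₂ n₃ × Fin 4 → Matrix.specialUnitaryGroup (Fin N) ℂ, Real.exp (-β * twistedExponent k U)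
        ∂(Measure.pi fun _ => haarProbability (Matrix.specialUnitaryGroup (Fin N) ℂ)) := rfl

end Def

/-! ## §2 K2–K7 through the identifier -/

section Readings

/-- The exponent is non-negative. [folklore] -/
theorem twistedExponent_nonneg (k : ZMod N) (U : FinTorusSite n₀ n₁ n₂ n₃ × Fin 4 → Matrix.specialUnitaryGroup (Fin N) ℂ) :
    0 ≤ twistedExponent k U :=
  twistedAction_nonneg (fundamentalRep_mem_unitaryGroup (n := Fin N)) _ U

/-- The exponent is continuous in the configuration. [folklore] -/
theorem continuous_twistedExponent (k : ZMod N) :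
    Continuous (twistedExponent (n₀ := n₀) (n₁ := n₁) (n₂ := n₂) (n₃ := n₃) k) :=
  continuous_twistedAction (continuous_fundamentalRep (Fin N)) _

/-- The exponent is gauge invariant. [folklore] -/
theorem twistedExponent_gaugeAct (k : ZMod N) (g : FinTorusSite n₀ n₁ n₂ n₃ → Matrix.specialUnitaryGroup (Fin N) ℂ)
    (U : FinTorusSite n₀ n₁ n₂ n₃ × Fin 4 → Matrix.specialUnitaryGroup (Fin N) ℂ) :
    twistedExponent k (gaugeAct g U) = twistedExponent k U := by
  have hw : ∀ μ ν, slabTwist (suCenter N k : Matrix.specialUnitaryGroup (Fin N) ℂ) 1 μ ν ∈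
      Subgroup.center (Matrix.specialUnitaryGroup (Fin N) ℂ) := fun μ ν => by
    unfold slabTwist; split_ifs
    · exact (suCenter N k).2
    · exact Subgroup.one_mem _
    · exact Subgroup.one_mem _
  exact twistedAction_gaugeAct (fundamentalRep (Fin N)) hw g U

variable {m m₀ m₁ m₂ m₃ : ℕ}

/-- ★★ **K2 through the identifier**: the zero set of the exponent is the union of the gauge orbits of the decorated twist-eating ladders.
[cite: Gonzalezarroyo1998, §4.2] -/
theorem twistedExponent_eq_zero_iff [NeZero N] {k : ZMod N} (hk : IsUnit k) {A B : Matrix.specialUnitaryGroup (Fin N) ℂ}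
    (hAB : B * A * B⁻¹ * A⁻¹ = (suCenter N k : Matrix.specialUnitaryGroup (Fin N) ℂ))
    (U : FinTorusSite (m₀ + 1) (m₁ + 1) (m₂ + 1) (m₃ + 1) × Fin 4 → Matrix.specialUnitaryGroup (Fin N) ℂ) :
    twistedExponent k U = 0 ↔
      ∃ (g : FinTorusSite (m₀ + 1) (m₁ + 1) (m₂ + 1) (m₃ + 1) → Matrix.specialUnitaryGroup (Fin N) ℂ) (i j : ZMod N),
        U = gaugeAct g (ladderConfig ![A, B, (suCenter N i : Matrix.specialUnitaryGroup (Fin N) ℂ),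
          (suCenter N j : Matrix.specialUnitaryGroup (Fin N) ℂ)]) :=
  twistedAction_eq_zero_iff_exists_gaugeAct_ladder_specialUnitary hk hAB (fundamentalRep_mem_unitaryGroup (n := Fin N))
    (fundamentalRep_injective (Fin N)) U

/-- ★ **K3e through the identifier**: along any `SU(N)` family `V t` with `↑(V t e) = e^{t a_e} · ↑(U₀ e)` the exponent is `lineAction`.
[cite: GarciaperezGonzalezarroyoOkawa2017, §2.3 (2.3)] -/
theorem twistedExponent_along_eq_lineAction (k : ZMod N) (U₀ : FinTorusSite n₀ n₁ n₂ n₃ × Fin 4 → Matrix.specialUnitaryGroup (Fin N) ℂ)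
    (a : Fin 4 → FinTorusSite n₀ n₁ n₂ n₃ → Matrix (Fin N) (Fin N) ℂ)
    (V : ℝ → FinTorusSite n₀ n₁ n₂ n₃ × Fin 4 → Matrix.specialUnitaryGroup (Fin N) ℂ)
    (hV : ∀ (t : ℝ) (x : FinTorusSite n₀ n₁ n₂ n₃) (μ : Fin 4),
      ((V t (x, μ) : Matrix.specialUnitaryGroup (Fin N) ℂ) : Matrix (Fin N) (Fin N) ℂ) = exp (t • a μ x) * (U₀ (x, μ) : Matrix (Fin N) (Fin N) ℂ)) :
    (fun t => twistedExponent k (V t)) = lineAction (fun e => (U₀ e : Matrix (Fin N) (Fin N) ℂ)) a (slabTwistPhase k) :=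
  funext fun t => twistedAction_along_eq_lineAction k U₀ a V hV t

/-- ★★★ **K3f through the identifier**: at EVERY zero of the exponent, along every `SU(N)` line `e^{ta}·U` with `a` traceless skew-Hermitian on the
Coulomb slice of `U`, `4 sin²(π/(N(m+1))) · Σ_x Σ_μ S(a_μ x) ≤ d²/dt²|₀ twistedExponent k (V t)`, uniformly in the long extents.
[cite: GarciaperezGonzalezarroyoOkawa2017, §2.2, §2.5] -/
theorem twistedExponent_hessian_gap_of_vacuum [NeZero N] {k : ZMod N} (hk : IsUnit k)
    (U : FinTorusSite (m + 1) (m + 1) (m₂ + 1) (m₃ + 1) × Fin 4 → Matrix.specialUnitaryGroup (Fin N) ℂ) (hU : twistedExponent k U = 0)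
    {a : Fin 4 → FinTorusSite (m + 1) (m + 1) (m₂ + 1) (m₃ + 1) → Matrix (Fin N) (Fin N) ℂ}
    (hskew : ∀ μ x, (a μ x)ᴴ = -a μ x) (htr : ∀ μ x, (a μ x).trace = 0)
    (hdiv : ∀ x, covDiv (fun e => ((U e : Matrix.specialUnitaryGroup (Fin N) ℂ) : Matrix (Fin N) (Fin N) ℂ)) a x = 0)
    (V : ℝ → FinTorusSite (m + 1) (m + 1) (m₂ + 1) (m₃ + 1) × Fin 4 → Matrix.specialUnitaryGroup (Fin N) ℂ)
    (hV : ∀ (t : ℝ) (x : FinTorusSite (m + 1) (m + 1) (m₂ + 1) (m₃ + 1)) (μ : Fin 4),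
      ((V t (x, μ) : Matrix.specialUnitaryGroup (Fin N) ℂ) : Matrix (Fin N) (Fin N) ℂ) = exp (t • a μ x) * (U (x, μ) : Matrix (Fin N) (Fin N) ℂ)) :
    4 * Real.sin (Real.pi / ((N : ℝ) * (m + 1 : ℕ))) ^ 2 * ∑ x, ∑ μ, (((a μ x)ᴴ * a μ x).trace).re ≤
      iteratedDeriv 2 (fun t => twistedExponent k (V t)) 0 :=
  twistedAction_hessian_gap_of_vacuum_specialUnitary hk U hU hskew htr hdiv V hV

/-- ★★ **K7 through the identifier**: the exponent is bounded below by some `η > 0` outside any open set containing the critical orbits.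
[cite: Breitung1994, Thm 41 (hypotheses)] -/
theorem twistedExponent_separation [NeZero N] {k : ZMod N} (hk : IsUnit k) {A B : Matrix.specialUnitaryGroup (Fin N) ℂ}
    (hAB : B * A * B⁻¹ * A⁻¹ = (suCenter N k : Matrix.specialUnitaryGroup (Fin N) ℂ))
    {W : Set (FinTorusSite (m₀ + 1) (m₁ + 1) (m₂ + 1) (m₃ + 1) × Fin 4 → Matrix.specialUnitaryGroup (Fin N) ℂ)} (hW : IsOpen W)
    (hWZ : ∀ (g : FinTorusSite (m₀ + 1) (m₁ + 1) (m₂ + 1) (m₃ + 1) → Matrix.specialUnitaryGroup (Fin N) ℂ) (i j : ZMod N),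
      gaugeAct g (ladderConfig ![A, B, (suCenter N i : Matrix.specialUnitaryGroup (Fin N) ℂ),
        (suCenter N j : Matrix.specialUnitaryGroup (Fin N) ℂ)]) ∈ W) :
    ∃ η : ℝ, 0 < η ∧ ∀ U : FinTorusSite (m₀ + 1) (m₁ + 1) (m₂ + 1) (m₃ + 1) × Fin 4 → Matrix.specialUnitaryGroup (Fin N) ℂ, U ∉ W →
      η ≤ twistedExponent k U :=
  twistedAction_separation_fundamental hk hAB hW hWZ

/-- **The chart value is the exponent** whenever the chart configuration is `SU(N)`-valued: if `↑(W (x,μ)) = e^{a_μ(x)} · ↑(U (x,μ))` then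
`twistedExponent k W = chartAction (↑U) (slabTwistPhase k) a` (so K4∕K5∕K6 are statements about the exponent in the exponential chart).
[cite: GarciaperezGonzalezarroyoOkawa2017, §2.3] -/
theorem twistedExponent_eq_chartAction_of_coe (k : ZMod N) (U : FinTorusSite n₀ n₁ n₂ n₃ × Fin 4 → Matrix.specialUnitaryGroup (Fin N) ℂ)
    (a : Fin 4 → FinTorusSite n₀ n₁ n₂ n₃ → Matrix (Fin N) (Fin N) ℂ) (W : FinTorusSite n₀ n₁ n₂ n₃ × Fin 4 → Matrix.specialUnitaryGroup (Fin N) ℂ)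
    (hW : ∀ (x : FinTorusSite n₀ n₁ n₂ n₃) (μ : Fin 4),
      ((W (x, μ) : Matrix.specialUnitaryGroup (Fin N) ℂ) : Matrix (Fin N) (Fin N) ℂ) = exp (a μ x) * (U (x, μ) : Matrix (Fin N) (Fin N) ℂ)) :
    twistedExponent k W = chartAction (fun e => (U e : Matrix (Fin N) (Fin N) ℂ)) (slabTwistPhase k) a := by
  unfold twistedExponent chartAction
  refine Finset.sum_congr rfl fun x _ => Finset.sum_congr rfl fun q _ => ?_
  rw [fundamentalRep_apply, Submonoid.coe_mul, coe_tHooftTwistTensor_slabTwist, coe_finTorusPlaquette_eq_bgPlaq, Matrix.smul_mul,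
    Matrix.one_mul]
  simp only [bgPlaq, chartPlaq, hW]

end Readings

end Summit.QuantumFields.YangMills.Cruxes.IRcof.TwistedSlab

end
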